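import Literature.IUT.LogVolume.IsometryMoverAscent
import HarnessLib

/-!
# Ascent of maximal-order movers in the NUMBER OF SLOTS: the slot-inclusion packet morphism
# `⊗_{j ∈ I'} K → ⊗_{i ∈ I} K` along an injection `e : I' ↪ I`

Classical multilinear / local algebra (nothing disputed; the [IUTchIV] locator records where the abc-iut cell uses
it).  [IUTchIV] Prop. 1.1 p. 9 attaches to a tensor packet `V_I = ⊗_{ℚ_p, i ∈ I} k_i` the maximal `ℤ_p`-order
`(R_I)^∼` (the tree's `normalizedPacket` = integral closure of `ℤ_p` in `V_I`, abc-iut-S5's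
`mem_normalizedPacket_iff_isIntegral`).  A tuple of factorwise `ℚ_p`-linear ISOMETRIES may MOVE `(R_I)^∼`; the
exhibits of record are TWO-slot ones, over `V = K ⊗ K` in the currency `PacketAlgebra p (fun _ : Fin 2 => K)` with the
mover `![g, 1]` (`WildCubicIsometryMover`, `WildQuadraticIsometryMover`, `WildDyadicCyclotomicIsometryMover`, the
isometric `p`-shear, …), and `IsometryMoverAscent` moves them along FIELD embeddings at a fixed index set.  THIS FILE
moves them along SLOT inclusions: for a constant slot field `K` and an injection `e : I' ↪ I` of finite index types,

* §1 the slot-inclusion `ℚ_p`-ALGEBRA map `φ_e : ⊗_{I'} K → ⊗_I K`, `⊗_j x_j ↦ ⊗_i x̃_i` with `x̃_{e(j)} = x_j` and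
  `x̃_i = 1` off the image of `e` (`exists_algHom_tprod_extend`; it is `PiTensorProduct.liftAlgHom` of
  `x ↦ Π_j ι_{e(j)}(x_j)`), which has a LEFT INVERSE algebra map (contract every slot off `e(I')` into a fixed slot
  `j₀`: `exists_leftInverse_of_tprod_extend`) and is therefore injective;
* §2 hence `φ_e` PRESERVES AND REFLECTS the maximal order, `φ_e x ∈ (R_I)^∼ ↔ x ∈ (R_{I'})^∼`
  (`map_mem_normalizedPacket_iff_of_injective`, integrality reflection along an injective algebra map, exactly as in
  `IsometryMoverAscent.map_mem_normalizedPacket_iff`), and INTERTWINES `⊗_j f_j` with `⊗_i F_i` whenever `F_{e(j)} = f_j`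
  and `F_i = id` off the image (`congr_extend_map_eq`);
* §3 **SLOT ASCENT** (`exists_isometries_mover_of_embedding`): if isometries `f_j` (`j ∈ I'`) move some
  `z ∈ (R_{I'})^∼` out of `(R_{I'})^∼`, then the isometries `F = (f on e(I'), id elsewhere)` move `φ_e z ∈ (R_I)^∼` out
  of `(R_I)^∼`; in the two-slot currency of record (`exists_isometries_mover_of_pair`,
  `exists_isometries_mover_of_two_le_card`): a mover `![g, 1]` on `K ⊗ K` yields, in EVERY packet shape `⊗_{i ∈ I} K`
  with `|I| ≥ 2` and every slot `i₀`, the mover "`g` at `i₀`, identity elsewhere".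

Use (abc-iut cell, R-J row Y-29b, the «slot-count» precision rider of the block-E adversary lanes): the MOVER half of
the dyadic-axis word is slot-count-free — every two-slot isometric mover of record bites every packet shape with at
least two slots.  Statement about CONTAINERS only; it takes no side on [IUTchIII] Cor. 3.12.  PROOF-ONLY file
(theorems, no definitions, no `Prop` facts).
[cite: Mochizuki2012, IUTchIV Prop. 1.1 p. 9] [cite: NeukirchANT1999, Ch. II Thm. (4.8)]
-/

noncomputable section

open Module Function Metric Set
open scoped TensorProduct

namespace Literature.IUT.LogVolume

namespace SlotAscent

variable (p : ℕ) [Fact p.Prime]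
variable {K : Type} [NontriviallyNormedField K] [NormedAlgebra ℚ_[p] K]
variable {I' I : Type} [Fintype I'] [Fintype I] [DecidableEq I'] [DecidableEq I]

/-! ## §1 The slot-inclusion algebra map and its left inverse -/

omit [Fintype I] [DecidableEq I'] in
/-- `Π_j δ_{e(j)}(x_j) = x̃` pointwise: the product over `j` of the functions "`x_j` at slot `e(j)`, `1` elsewhere" is
the padded family `x̃ = Function.extend e x 1`. [folklore] -/
private theorem prod_mulSingle_eq_extend (e : I' ↪ I) (x : I' → K) :
    ∏ j, (Pi.mulSingle (e j) (x j) : I → K) = Function.extend e x 1 := by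
  funext i
  rw [Finset.prod_apply]
  by_cases hi : ∃ j, e j = i
  · obtain ⟨j, rfl⟩ := hi
    rw [e.injective.extend_apply, Finset.prod_eq_single j]
    · exact Pi.mulSingle_eq_same _ _
    · intro j' _ hj'
      exact Pi.mulSingle_eq_of_ne (fun h => hj' (e.injective h).symm) _
    · intro h; exact absurd (Finset.mem_univ j) h
  · rw [Function.extend_apply' _ _ _ hi, Pi.one_apply]
    exact Finset.prod_eq_one fun j _ => Pi.mulSingle_eq_of_ne (fun h => hi ⟨j, h.symm⟩) _

omit [Fintype I] [DecidableEq I'] in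
/-- `ι_i(a) = ⊗ δ_i(a)` (unfolding of the coprojection). [cite: Mochizuki2012, IUTchIV Prop. 1.1 p. 9] -/
theorem iota_eq_tprod_mulSingle (i : I) (a : K) :
    iota p (fun _ : I => K) i a = PiTensorProduct.tprod ℚ_[p] (Pi.mulSingle i a : I → K) := rfl

omit [Fintype I] [DecidableEq I'] in
/-- **The slot-inclusion algebra map exists**: a `ℚ_p`-algebra homomorphism `φ_e : ⊗_{I'} K → ⊗_I K` with
`φ_e(⊗_j x_j) = ⊗_i x̃_i`, `x̃ = Function.extend e x 1` (`x̃_{e(j)} = x_j`, `x̃_i = 1` off `e(I')`). It is the lift of the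
multiplicative multilinear map `x ↦ Π_j ι_{e(j)}(x_j)`. [cite: Mochizuki2012, IUTchIV Prop. 1.1 p. 9] -/
theorem exists_algHom_tprod_extend (e : I' ↪ I) :
    ∃ φ : PacketAlgebra p (fun _ : I' => K) →ₐ[ℚ_[p]] PacketAlgebra p (fun _ : I => K),
      ∀ x : I' → K, φ (PiTensorProduct.tprod ℚ_[p] x) = PiTensorProduct.tprod ℚ_[p] (Function.extend e x 1) := by
  let f : MultilinearMap ℚ_[p] (fun _ : I' => K) (PacketAlgebra p (fun _ : I => K)) :=
    (MultilinearMap.mkPiAlgebra ℚ_[p] I' (PacketAlgebra p (fun _ : I => K))).compLinearMap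
      fun j => (iota p (fun _ : I => K) (e j)).toLinearMap
  have hf : ∀ x, f x = ∏ j, iota p (fun _ : I => K) (e j) (x j) := fun x => by
    simp only [f, MultilinearMap.compLinearMap_apply, MultilinearMap.mkPiAlgebra_apply, AlgHom.toLinearMap_apply]
  have hone : f 1 = 1 := by
    rw [hf]; exact Finset.prod_eq_one fun j _ => by rw [Pi.one_apply, map_one]
  have hmul : ∀ x y, f (x * y) = f x * f y := fun x y => by
    rw [hf, hf, hf, ← Finset.prod_mul_distrib]
    exact Finset.prod_congr rfl fun j _ => by rw [Pi.mul_apply, map_mul]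
  refine ⟨PiTensorProduct.liftAlgHom f hone hmul, fun x => ?_⟩
  rw [PiTensorProduct.liftAlgHom_apply, PiTensorProduct.lift.tprod, hf, ← prod_mulSingle_eq_extend,
    PiTensorProduct.tprod_prod]
  rfl

/-! ## §2 Reflection of the maximal order along an injective packet algebra map -/

omit [DecidableEq I'] [DecidableEq I] in
/-- **An injective algebra map of packets preserves and reflects the maximal order**: `φ x ∈ (R_I)^∼ ↔ x ∈ (R_{I'})^∼`
(both are the integral closures of `ℤ_p`; integrality is preserved by algebra maps and reflected by injective ones).
[cite: Mochizuki2012, IUTchIV Prop. 1.1 p. 9] -/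
theorem map_mem_normalizedPacket_iff_of_injective [Nonempty I'] [Nonempty I] [IsUltrametricDist K] [ProperSpace K]
    (φ : PacketAlgebra p (fun _ : I' => K) →ₐ[ℚ_[p]] PacketAlgebra p (fun _ : I => K)) (hinj : Function.Injective φ)
    {x : PacketAlgebra p (fun _ : I' => K)} :
    φ x ∈ normalizedPacket p (fun _ : I => K) ↔ x ∈ normalizedPacket p (fun _ : I' => K) := by
  rw [mem_normalizedPacket_iff_isIntegral, mem_normalizedPacket_iff_isIntegral]
  exact isIntegral_algHom_iff (φ.restrictScalars ℤ_[p]) hinj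

section Phi

variable (e : I' ↪ I) (φ : PacketAlgebra p (fun _ : I' => K) →ₐ[ℚ_[p]] PacketAlgebra p (fun _ : I => K))
  (hφ : ∀ x : I' → K, φ (PiTensorProduct.tprod ℚ_[p] x) = PiTensorProduct.tprod ℚ_[p] (Function.extend e x 1))
include hφ

omit [Fintype I] in
/-- `φ_e(ι_j(a)) = ι_{e(j)}(a)`. [cite: Mochizuki2012, IUTchIV Prop. 1.1 p. 9] -/
theorem map_iota (j : I') (a : K) :
    φ (iota p (fun _ : I' => K) j a) = iota p (fun _ : I => K) (e j) a := by
  rw [iota_eq_tprod_mulSingle, iota_eq_tprod_mulSingle, hφ]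
  congr 1
  funext i
  by_cases hi : ∃ j', e j' = i
  · obtain ⟨j', rfl⟩ := hi
    rw [e.injective.extend_apply]
    by_cases hj : j' = j
    · subst hj; rw [Pi.mulSingle_eq_same, Pi.mulSingle_eq_same]
    · rw [Pi.mulSingle_eq_of_ne hj, Pi.mulSingle_eq_of_ne (fun h => hj (e.injective h))]
  · rw [Function.extend_apply' _ _ _ hi, Pi.one_apply,
      Pi.mulSingle_eq_of_ne (fun h => hi ⟨j, h.symm⟩)]

/-- **`φ_e` has a left inverse** (an algebra map `ψ : ⊗_I K → ⊗_{I'} K`, `ψ ∘ φ_e = id`): send slot `e(j)` to slot `j`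
and every slot off `e(I')` to a fixed slot `j₀` (`I'` non-empty), i.e. `ψ(⊗_i y_i) = Π_i ι_{s(i)}(y_i)` with
`s = Function.extend e id j₀`. [cite: Mochizuki2012, IUTchIV Prop. 1.1 p. 9] -/
theorem exists_leftInverse_of_tprod_extend [Nonempty I'] :
    ∃ ψ : PacketAlgebra p (fun _ : I => K) →ₐ[ℚ_[p]] PacketAlgebra p (fun _ : I' => K), ∀ x, ψ (φ x) = x := by
  obtain ⟨j₀⟩ := ‹Nonempty I'›
  let s : I → I' := Function.extend e id fun _ => j₀
  have hs : ∀ j, s (e j) = j := fun j => e.injective.extend_apply _ _ j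
  let g : MultilinearMap ℚ_[p] (fun _ : I => K) (PacketAlgebra p (fun _ : I' => K)) :=
    (MultilinearMap.mkPiAlgebra ℚ_[p] I (PacketAlgebra p (fun _ : I' => K))).compLinearMap
      fun i => (iota p (fun _ : I' => K) (s i)).toLinearMap
  have hg : ∀ y, g y = ∏ i, iota p (fun _ : I' => K) (s i) (y i) := fun y => by
    simp only [g, MultilinearMap.compLinearMap_apply, MultilinearMap.mkPiAlgebra_apply, AlgHom.toLinearMap_apply]
  have hone : g 1 = 1 := by
    rw [hg]; exact Finset.prod_eq_one fun i _ => by rw [Pi.one_apply, map_one]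
  have hmul : ∀ x y, g (x * y) = g x * g y := fun x y => by
    rw [hg, hg, hg, ← Finset.prod_mul_distrib]
    exact Finset.prod_congr rfl fun i _ => by rw [Pi.mul_apply, map_mul]
  let ψ := PiTensorProduct.liftAlgHom g hone hmul
  have hψι : ∀ (i : I) (a : K), ψ (iota p (fun _ : I => K) i a) = iota p (fun _ : I' => K) (s i) a := by
    intro i a
    rw [iota_eq_tprod_mulSingle, PiTensorProduct.liftAlgHom_apply, PiTensorProduct.lift.tprod, hg,
      Finset.prod_eq_single i]
    · rw [Pi.mulSingle_eq_same]
    · intro i' _ hi'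
      rw [Pi.mulSingle_eq_of_ne hi', map_one]
    · intro h; exact absurd (Finset.mem_univ i) h
  have hcomp : ψ.comp φ = AlgHom.id ℚ_[p] _ := by
    refine PiTensorProduct.algHom_ext fun j => ?_
    ext a
    change ψ (φ (iota p (fun _ : I' => K) j a)) = iota p (fun _ : I' => K) j a
    rw [map_iota p e φ hφ, hψι, hs]
  exact ⟨ψ, fun x => by simpa using congrArg (fun h => h x) hcomp⟩

/-- `φ_e` is injective. [cite: Mochizuki2012, IUTchIV Prop. 1.1 p. 9] -/
theorem injective_of_tprod_extend [Nonempty I'] : Function.Injective φ := by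
  obtain ⟨ψ, hψ⟩ := exists_leftInverse_of_tprod_extend p e φ hφ
  exact Function.LeftInverse.injective hψ

/-! ## §2' Intertwining -/

omit [Fintype I] [DecidableEq I'] in
/-- **Intertwining**: if `F_{e(j)} = f_j` and `F_i = id` off `e(I')`, then `(⊗_i F_i) ∘ φ_e = φ_e ∘ (⊗_j f_j)`.
[cite: Mochizuki2012, IUTchIV Prop. 1.1 p. 9] -/
theorem congr_extend_map_eq (f : I' → (K ≃ₗ[ℚ_[p]] K)) (F : I → (K ≃ₗ[ℚ_[p]] K))
    (hF : ∀ j, F (e j) = f j) (hF1 : ∀ i, (¬ ∃ j, e j = i) → F i = LinearEquiv.refl ℚ_[p] K)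
    (z : PacketAlgebra p (fun _ : I' => K)) :
    (PiTensorProduct.congr F : PacketAlgebra p (fun _ : I => K) ≃ₗ[ℚ_[p]] PacketAlgebra p (fun _ : I => K)) (φ z) =
      φ ((PiTensorProduct.congr f :
        PacketAlgebra p (fun _ : I' => K) ≃ₗ[ℚ_[p]] PacketAlgebra p (fun _ : I' => K)) z) := by
  have h : (PiTensorProduct.congr F :
        PacketAlgebra p (fun _ : I => K) ≃ₗ[ℚ_[p]] PacketAlgebra p (fun _ : I => K)).toLinearMap ∘ₗ φ.toLinearMap =
      φ.toLinearMap ∘ₗ (PiTensorProduct.congr f :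
        PacketAlgebra p (fun _ : I' => K) ≃ₗ[ℚ_[p]] PacketAlgebra p (fun _ : I' => K)).toLinearMap := by
    refine PiTensorProduct.ext ?_
    refine MultilinearMap.ext fun x => ?_
    simp only [LinearMap.compMultilinearMap_apply, LinearMap.coe_comp, Function.comp_apply,
      LinearEquiv.coe_coe, AlgHom.toLinearMap_apply, PiTensorProduct.congr_tprod]
    rw [hφ, hφ, PiTensorProduct.congr_tprod]
    congr 1
    funext i
    by_cases hi : ∃ j, e j = i
    · obtain ⟨j, rfl⟩ := hi
      rw [e.injective.extend_apply, e.injective.extend_apply, hF]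
    · rw [Function.extend_apply' _ _ _ hi, Function.extend_apply' _ _ _ hi, hF1 i hi]
      rfl
  exact LinearMap.congr_fun h z

end Phi

/-! ## §3 Slot ascent of movers -/

/-- **SLOT ASCENT OF MAXIMAL-ORDER MOVERS.**  If factorwise `ℚ_p`-linear isometries `f_j` (`j ∈ I'`) move a point
`z ∈ (R_{I'})^∼` out of `(R_{I'})^∼`, then along any injection of slots `e : I' ↪ I` the isometries
`F = Function.extend e f id` (`F_{e(j)} = f_j`, identity on the other slots) move `φ_e z ∈ (R_I)^∼` out of `(R_I)^∼`.
[cite: Mochizuki2012, IUTchIV Prop. 1.1 p. 9] [cite: NeukirchANT1999, Ch. II Thm. (4.8)] -/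
theorem exists_isometries_mover_of_embedding [Nonempty I'] [IsUltrametricDist K] [ProperSpace K] (e : I' ↪ I)
    (f : I' → (K ≃ₗ[ℚ_[p]] K)) (hf : ∀ j x, ‖f j x‖ = ‖x‖)
    {z : PacketAlgebra p (fun _ : I' => K)} (hz : z ∈ normalizedPacket p (fun _ : I' => K))
    (hmv : (PiTensorProduct.congr f :
        PacketAlgebra p (fun _ : I' => K) ≃ₗ[ℚ_[p]] PacketAlgebra p (fun _ : I' => K)) z ∉
      normalizedPacket p (fun _ : I' => K)) :
    ∃ F : I → (K ≃ₗ[ℚ_[p]] K), (∀ i x, ‖F i x‖ = ‖x‖) ∧ (∀ j, F (e j) = f j) ∧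
      (∀ i, (¬ ∃ j, e j = i) → F i = LinearEquiv.refl ℚ_[p] K) ∧
      ∃ Z : PacketAlgebra p (fun _ : I => K), Z ∈ normalizedPacket p (fun _ : I => K) ∧
        (PiTensorProduct.congr F :
            PacketAlgebra p (fun _ : I => K) ≃ₗ[ℚ_[p]] PacketAlgebra p (fun _ : I => K)) Z ∉
          normalizedPacket p (fun _ : I => K) := by
  haveI : Nonempty I := ⟨e (Classical.arbitrary I')⟩
  obtain ⟨φ, hφ⟩ := exists_algHom_tprod_extend p (K := K) e
  have hinj := injective_of_tprod_extend p e φ hφ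
  let F : I → (K ≃ₗ[ℚ_[p]] K) := Function.extend e f fun _ => LinearEquiv.refl ℚ_[p] K
  have hF : ∀ j, F (e j) = f j := fun j => e.injective.extend_apply _ _ j
  have hF1 : ∀ i, (¬ ∃ j, e j = i) → F i = LinearEquiv.refl ℚ_[p] K := fun i hi =>
    Function.extend_apply' _ _ _ hi
  refine ⟨F, fun i x => ?_, hF, hF1, φ z,
    (map_mem_normalizedPacket_iff_of_injective p φ hinj).mpr hz, fun h => hmv ?_⟩
  · by_cases hi : ∃ j, e j = i
    · obtain ⟨j, rfl⟩ := hi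
      rw [hF]
      exact hf j x
    · rw [hF1 i hi]
      rfl
  · rw [congr_extend_map_eq p e φ hφ f F hF hF1 z] at h
    exact (map_mem_normalizedPacket_iff_of_injective p φ hinj).mp h

omit [Fintype I] [DecidableEq I] in
/-- Two distinct slots give an injection `Fin 2 ↪ I`. [folklore] -/
private theorem injective_vecCons_pair {i₀ i₁ : I} (hne : i₀ ≠ i₁) : Function.Injective (![i₀, i₁] : Fin 2 → I) := by
  intro a b h
  fin_cases a <;> fin_cases b
  · rfl
  · exact absurd h hne
  · exact absurd h.symm hne
  · rfl

/-- **Every two-slot mover of record bites every packet shape with two named slots**: from a mover `![g, 1]` of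
`(R_{Fin 2})^∼ ⊆ K ⊗ K` (the currency of `WildCubicIsometryMover.exists_isometry_maxOrder_mover` and its siblings) and
slots `i₀ ≠ i₁` of `I`, the tuple "`g` at `i₀`, identity at every other slot" moves `(R_I)^∼ ⊆ ⊗_{i ∈ I} K`.
[cite: Mochizuki2012, IUTchIV Prop. 1.1 p. 9] -/
theorem exists_isometries_mover_of_pair [IsUltrametricDist K] [ProperSpace K] {i₀ i₁ : I} (hne : i₀ ≠ i₁)
    (g : K ≃ₗ[ℚ_[p]] K) (hg : ∀ x, ‖g x‖ = ‖x‖) {z : PacketAlgebra p (fun _ : Fin 2 => K)}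
    (hz : z ∈ (normalizedPacket p (fun _ : Fin 2 => K) : Set (PacketAlgebra p (fun _ : Fin 2 => K))))
    (hmv : (PiTensorProduct.congr (![g, LinearEquiv.refl ℚ_[p] K] : ∀ _ : Fin 2, K ≃ₗ[ℚ_[p]] K) :
        PacketAlgebra p (fun _ : Fin 2 => K) ≃ₗ[ℚ_[p]] PacketAlgebra p (fun _ : Fin 2 => K)) z ∉
      (normalizedPacket p (fun _ : Fin 2 => K) : Set (PacketAlgebra p (fun _ : Fin 2 => K)))) :
    ∃ F : I → (K ≃ₗ[ℚ_[p]] K), (∀ i x, ‖F i x‖ = ‖x‖) ∧ F i₀ = g ∧ (∀ i, i ≠ i₀ → F i = LinearEquiv.refl ℚ_[p] K) ∧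
      ∃ Z : PacketAlgebra p (fun _ : I => K),
        Z ∈ (normalizedPacket p (fun _ : I => K) : Set (PacketAlgebra p (fun _ : I => K))) ∧
          (PiTensorProduct.congr F :
              PacketAlgebra p (fun _ : I => K) ≃ₗ[ℚ_[p]] PacketAlgebra p (fun _ : I => K)) Z ∉
            (normalizedPacket p (fun _ : I => K) : Set (PacketAlgebra p (fun _ : I => K))) := by
  let e : Fin 2 ↪ I := ⟨![i₀, i₁], injective_vecCons_pair hne⟩
  have hf : ∀ (j : Fin 2) (x : K), ‖(![g, LinearEquiv.refl ℚ_[p] K] : ∀ _ : Fin 2, K ≃ₗ[ℚ_[p]] K) j x‖ = ‖x‖ := by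
    intro j x
    fin_cases j
    · exact hg x
    · rfl
  obtain ⟨F, hFiso, hF, hF1, Z, hZ, hmZ⟩ :=
    exists_isometries_mover_of_embedding p e _ hf (z := z) hz hmv
  refine ⟨F, hFiso, by simpa [e] using hF 0, fun i hi => ?_, Z, hZ, hmZ⟩
  by_cases h1 : i = i₁
  · subst h1
    simpa [e] using hF 1
  · refine hF1 i ?_
    rintro ⟨j, rfl⟩
    fin_cases j
    · exact hi rfl
    · exact h1 rfl

/-- **… hence every packet shape with at least two slots**: `2 ≤ |I|` and a two-slot mover `![g, 1]` give factorwise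
isometries of `⊗_{i ∈ I} K` moving `(R_I)^∼`. [cite: Mochizuki2012, IUTchIV Prop. 1.1 p. 9] -/
theorem exists_isometries_mover_of_two_le_card [IsUltrametricDist K] [ProperSpace K] (hI : 2 ≤ Fintype.card I)
    (g : K ≃ₗ[ℚ_[p]] K) (hg : ∀ x, ‖g x‖ = ‖x‖) {z : PacketAlgebra p (fun _ : Fin 2 => K)}
    (hz : z ∈ (normalizedPacket p (fun _ : Fin 2 => K) : Set (PacketAlgebra p (fun _ : Fin 2 => K))))
    (hmv : (PiTensorProduct.congr (![g, LinearEquiv.refl ℚ_[p] K] : ∀ _ : Fin 2, K ≃ₗ[ℚ_[p]] K) :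
        PacketAlgebra p (fun _ : Fin 2 => K) ≃ₗ[ℚ_[p]] PacketAlgebra p (fun _ : Fin 2 => K)) z ∉
      (normalizedPacket p (fun _ : Fin 2 => K) : Set (PacketAlgebra p (fun _ : Fin 2 => K)))) :
    ∃ F : I → (K ≃ₗ[ℚ_[p]] K), (∀ i x, ‖F i x‖ = ‖x‖) ∧
      ∃ Z : PacketAlgebra p (fun _ : I => K),
        Z ∈ (normalizedPacket p (fun _ : I => K) : Set (PacketAlgebra p (fun _ : I => K))) ∧
          (PiTensorProduct.congr F :
              PacketAlgebra p (fun _ : I => K) ≃ₗ[ℚ_[p]] PacketAlgebra p (fun _ : I => K)) Z ∉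
            (normalizedPacket p (fun _ : I => K) : Set (PacketAlgebra p (fun _ : I => K))) := by
  obtain ⟨i₀, i₁, hne⟩ := Fintype.exists_pair_of_one_lt_card hI
  obtain ⟨F, hFiso, -, -, Z, hZ, hmZ⟩ := exists_isometries_mover_of_pair p hne g hg hz hmv
  exact ⟨F, hFiso, Z, hZ, hmZ⟩

end SlotAscent

namespace SlotAscent

/-- **Example of record in every shape**: the WILD CUBIC mover (`exists_isometry_maxOrder_mover`: `[K : ℚ₃] = 3`,
`π³ = 3`, a reflection isometry `f₀` and a point of `(R_I)^∼ ⊆ K ⊗ K` moved by `![f₀, 1]`) yields factorwise isometries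
moving `(R_I)^∼ ⊆ ⊗_{i ∈ I} K` for EVERY finite index type with `2 ≤ |I|`. [cite: Mochizuki2012, IUTchIV Prop. 1.1 p. 9] -/
theorem exists_isometries_mover_cubic_of_two_le_card {K : Type} [NontriviallyNormedField K] [NormedAlgebra ℚ_[3] K]
    [IsUltrametricDist K] [ProperSpace K] {π : K} (hK : Module.finrank ℚ_[3] K = 3) (hπ : π ^ 3 = 3)
    {I : Type} [Fintype I] [DecidableEq I] (hI : 2 ≤ Fintype.card I) :
    ∃ F : I → (K ≃ₗ[ℚ_[3]] K), (∀ i x, ‖F i x‖ = ‖x‖) ∧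
      ∃ Z : PacketAlgebra 3 (fun _ : I => K),
        Z ∈ (normalizedPacket 3 (fun _ : I => K) : Set (PacketAlgebra 3 (fun _ : I => K))) ∧
          (PiTensorProduct.congr F :
              PacketAlgebra 3 (fun _ : I => K) ≃ₗ[ℚ_[3]] PacketAlgebra 3 (fun _ : I => K)) Z ∉
            (normalizedPacket 3 (fun _ : I => K) : Set (PacketAlgebra 3 (fun _ : I => K))) := by
  obtain ⟨f₀, hiso, -, z, hz, hmv⟩ := exists_isometry_maxOrder_mover (K := K) hK hπ
  exact exists_isometries_mover_of_two_le_card 3 hI f₀ hiso hz hmv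

end SlotAscent

end Literature.IUT.LogVolume

end
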